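import Summits.QuantumFields.YangMills.Theorems.UnitScaleTiltProp7SymAvgTwSymDefs
import Summits.QuantumFields.YangMills.Theorems.BalabanUVNodesK0Stub1DoubleBarFibreDictionary
import HarnessLib

/-!
# (q-gauge) SUPPLIER, §1 — **THE EXACT GAUGE COVARIANCE OF THE RE-BASED TWISTED DOUBLE BAR AT A GENERAL CHART POINT**
# `U̿^{twS}(A′)(c) = k(ĉ₋) · U̿^{twS}(A)(c) · Ū₀(ĉ)·k(ĉ₊)⁻¹·Ū₀(ĉ)⁻¹` whenever `e^{A′}U₀ = (e^{A}U₀)^{g}`, with the coarse gauge map `k := (w_{A′})⁻¹·(g∘x̂⁽ᵏ⁾)·w_A`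
# ([Balaban1985Averaging] (11) covariance of the `k`-fold average, (97) the frames; [Balaban1985BackgroundPropagators] (3.114)–(3.115))

Cell `ym3-torus` (HUMAN RULING D-0037, YM ladder rung R3 — SU(2) YM₃ on T³: NOT d = 4, NOT infinite volume, NOT a mass gap, NOT Clay).  Width seat `ym3-torus-px19` (gen 14);
chair ★`ym-ust-19200-p1` g27 WORD №29 (2) «(q-gauge) → px19 g14: GO»; px19 g14 LOCATE-S1 (1) (bus 2026-08-30T10:02Z).  THEOREMS ONLY (0 `def`, 0 `sorry`, default heartbeats);
`--supports stmt-QuantumFields-19200 --as helper`; count-neutral; NO claim on crux ∕ stub ∕ registry.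

THE PRINT.  [Balaban1985Averaging] (8) p.19 (gauge action), (11) p.19 («Ū(V^u) = (ŪV)^{u}» read at the block centres), (89)–(92) p.31, (97) p.32 (the accumulated frames);
[Balaban1985BackgroundPropagators] (3.114)–(3.115) p.418 («Q_j(D_Uλ) = D_{U_j}(Q′_jλ)» — the infinitesimal form AT THE BACKGROUND, ✓`Prop7SymAvgTwSGaugeDir.QTwS_gaugeDir_of_avgSeq`).

WHY (LOCATE-S1 (1)).  The row `hqG` of ✓⧗`Prop7TJDivRowOfColumns.hTJdiv_of_hHcol_hqG` (the «gauge-spike» column of `avgHess = D²(log U̿^{twS})(0)`) is the second-order reading of the gauge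
covariance of the averaging; its first-order reading at `A = 0` is landed.  This file records the EXACT (all orders, every chart point `A`) covariance of the double bar `U̿^{twS}` under a
fine gauge copy, from three landed identities — (92)∕(97) ✓`dbarTwS_eq_dbarCovIterU_mul_inv`, ✓`dbarCovIterU_eq_gaugeActT_frameAccU`, and (11) ✓`emlIterU_gaugeActT_fine` — by
group algebra: the frames are taken against the FIXED background `U₀`, so the gauge copy is seen through the frame-corrected coarse map `k = w_{A′}⁻¹·(g∘x̂)·w_A` (whose `t`-derivative
along `g_t = e^{tN}` is FR₁'s `ω`, ✓`Prop7SymFrameGaugeResponseAt`; at `A = A′ = 0`, `k = g∘x̂`).  The second-order identity (LOCATE-S1 (2)) differentiates this law.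

WHAT IS PROVED (generic `P`, complete normed ℂ-algebra `𝔸`; then the T³ member).
* §1 `gaugeActT_comp` (composition of coarse gauge maps), ★★ `dbarCovIterU_gaugeActT_fixedBg` — `U̿⁽ᵏ⁾_{U₀}(W^{g}) = (U̿⁽ᵏ⁾_{U₀}W)^{k}`, `k z = (v_k(W^g) z)⁻¹·g(x̂z)·v_k(W) z`.
* §2 ★★★ `dbarTwS_eq_of_gaugeActT` — at the T³ member: for `e^{A′(b)}U₀(b) = (e^{A}U₀)^{g}(b)` (all `b`),
  `dbarTwS U₀ A′ c = k(ĉ₋) · dbarTwS U₀ A c · (Ū₀(ĉ)·k(ĉ₊)⁻¹·Ū₀(ĉ)⁻¹)`, `Ū₀ = emlIterU (K−n) U₀♭`, `ĉ = bondShift c`.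
HONEST SCOPE.  Exact group∕lattice algebra over landed identities; no estimate, no derivative; nothing of (q-gauge), norm_G, the 8 EX rows, EX, the crux or rung R3 is proved; the Yang–Mills
mass gap is NOT proved.

References: T. Bałaban, CMP **98** (1985) 17–51 [Balaban1985Averaging] ((8)–(11) p.19, (89)–(92) p.31, (97) p.32); CMP **99** (1985) 389–434 [Balaban1985BackgroundPropagators]
((3.114)–(3.115) p.418).
-/

set_option autoImplicit false

noncomputable section

open scoped Matrix.Norms.L2Operator

namespace Summit.QuantumFields.YangMills.Theorems.Prop7ChartGaugeCovariance

open Literature.MathematicalPhysics.QuantumFieldTheory.Balaban1983to89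
open Literature.MathematicalPhysics.QuantumFieldTheory.Balaban1983to89.T3ContinuumYM3Torus
open B10Eq27TorusAxialLog (gaugeActT gaugeActT_apply)
open B7Prop1Explicit (expUnit)
open T3LevelShift (siteShift bondShift bondShift_tgt bondShift_src)
open T3PrintedRegularOrbits (sites_eq)
open T3SectALandauChart (bgUnits)
open Summit.QuantumFields.YangMills.Theorems.Prop8Chart (emlIterU)
open Summit.QuantumFields.YangMills.Theorems.Prop7SymAvgTwSym (frameAccU dbarCovIterU dbarCovIterU_eq_gaugeActT_frameAccU frameTwS dbarTwS frameTwS_def dbarTwS_eq_dbarCovIterU_mul_inv)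
open B15DeterminingSets (embIter)
open Summit.QuantumFields.YangMills.Theorems.K0Stub1DoubleBarFibreDictionary (emlIterU_gaugeActT_fine)

/-! ## §1 Generic: the covariant tower of a gauge copy -/

section Generic

variable {P : Params} {𝔸 : Type*} [NormedRing 𝔸] [NormedAlgebra ℂ 𝔸] [CompleteSpace 𝔸]

omit [NormedAlgebra ℂ 𝔸] [CompleteSpace 𝔸] in
/-- Composition of coarse gauge maps: `(V^{v})^{u} = V^{u·v}`. [cite: Balaban1985Averaging, (8) p.19] -/
theorem gaugeActT_comp {k : ℕ} (u v : Site P k → 𝔸ˣ) (V : GaugeField P k 𝔸ˣ) :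
    gaugeActT u (gaugeActT v V) = gaugeActT (fun x => u x * v x) V := by
  funext b
  simp only [gaugeActT_apply, mul_inv_rev, mul_assoc]

/-- ★★ **THE COVARIANT TOWER OF A FINE GAUGE COPY**: `U̿⁽ᵏ⁾_{U₀}(W^{g}) = (U̿⁽ᵏ⁾_{U₀}W)^{k}` with the frame-corrected coarse map `k z := (v_k(W^{g}) z)⁻¹ · g(x̂⁽ᵏ⁾z) · v_k(W) z`
(`v_k = frameAccU k U₀`, frames against the FIXED `U₀`) — (97) twice and (11).  (Cousin: ✓`Prop7SymFrameCovariance.dbarCovIterU_gaugeActT` is the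
SIMULTANEOUS action on background and field by a consistent tower; here the background stays fixed and the frames respond.) [cite: Balaban1985Averaging, (11) p.19, (97) p.32] -/
theorem dbarCovIterU_gaugeActT_fixedBg (U₀ W : GaugeField P 0 𝔸ˣ) (g : Site P 0 → 𝔸ˣ) (k : ℕ) :
    dbarCovIterU k U₀ (gaugeActT g W)
      = gaugeActT (fun z : Site P k => (frameAccU k U₀ (gaugeActT g W) z)⁻¹ * g (embIter k z) * frameAccU k U₀ W z) (dbarCovIterU k U₀ W) := by
  rw [dbarCovIterU_eq_gaugeActT_frameAccU U₀ (gaugeActT g W) k, dbarCovIterU_eq_gaugeActT_frameAccU U₀ W k, emlIterU_gaugeActT_fine, gaugeActT_comp, gaugeActT_comp]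
  congr 1
  funext z
  rw [mul_assoc, mul_assoc, mul_inv_cancel, mul_one]

end Generic

/-! ## §2 The T³ member: the re-based twisted double bar of a gauge copy -/

section Member

variable {F : T3Family} {n K : ℕ} {h : n ≤ K}

/-- ★★★ **EXACT GAUGE COVARIANCE OF `U̿^{twS}` AT A GENERAL CHART POINT**: if `e^{A′}U₀ = (e^{A}U₀)^{g}` bondwise, then for every coarse bond `c`,
`U̿^{twS}(A′)(c) = k(ĉ₋) · U̿^{twS}(A)(c) · (Ū₀(ĉ)·k(ĉ₊)⁻¹·Ū₀(ĉ)⁻¹)` with `k z = (v(A′) z)⁻¹·g(x̂z)·v(A) z`, `v(A) = frameAccU (K−n) U₀♭ (e^{A}U₀♭)`, `Ū₀ = emlIterU (K−n) U₀♭`,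
`ĉ = bondShift c` — i.e. `log U̿^{twS}` intertwines the fine chart gauge action with the COARSE chart gauge action of `k` around `Ū₀`.  At `A = A′ = 0` (`g = 1`) both sides are `1`;
the `t`-derivative of `k` along `g_t = e^{tN}` is FR₁'s frame-corrected `ω`. [cite: Balaban1985Averaging, (11) p.19, (92) p.31, (97) p.32; Balaban1985BackgroundPropagators, (3.114)–(3.115) p.418] -/
theorem dbarTwS_eq_of_gaugeActT (U₀ : GaugeField (F.P K) 0 (Matrix.specialUnitaryGroup (Fin 2) ℂ)) (g : Site (F.P K) 0 → (Matrix (Fin 2) (Fin 2) ℂ)ˣ)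
    (A A' : PBond (F.P K) 0 → Matrix (Fin 2) (Fin 2) ℂ)
    (hA' : (fun b => expUnit (A' b) * bgUnits F K U₀ b) = gaugeActT g (fun b => expUnit (A b) * bgUnits F K U₀ b)) (c : PBond (F.P n) 0) :
    dbarTwS F n K h U₀ A' c
      = ((frameAccU (K - n) (bgUnits F K U₀) (fun b => expUnit (A' b) * bgUnits F K U₀ b) (bondShift (sites_eq F n K h) c).src)⁻¹
            * g (embIter (K - n) (bondShift (sites_eq F n K h) c).src)
            * frameAccU (K - n) (bgUnits F K U₀) (fun b => expUnit (A b) * bgUnits F K U₀ b) (bondShift (sites_eq F n K h) c).src)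
        * dbarTwS F n K h U₀ A c
        * (emlIterU (K - n) (bgUnits F K U₀) (bondShift (sites_eq F n K h) c)
            * ((frameAccU (K - n) (bgUnits F K U₀) (fun b => expUnit (A' b) * bgUnits F K U₀ b) (bondShift (sites_eq F n K h) c).tgt)⁻¹
                * g (embIter (K - n) (bondShift (sites_eq F n K h) c).tgt)
                * frameAccU (K - n) (bgUnits F K U₀) (fun b => expUnit (A b) * bgUnits F K U₀ b) (bondShift (sites_eq F n K h) c).tgt)⁻¹
            * (emlIterU (K - n) (bgUnits F K U₀) (bondShift (sites_eq F n K h) c))⁻¹) := by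
  rw [dbarTwS_eq_dbarCovIterU_mul_inv, dbarTwS_eq_dbarCovIterU_mul_inv, hA', dbarCovIterU_gaugeActT_fixedBg, gaugeActT_apply]
  simp only [mul_assoc, inv_mul_cancel_left]
  rfl

end Member

end Summit.QuantumFields.YangMills.Theorems.Prop7ChartGaugeCovariance

end
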